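import Summits.NavierStokesRegularity.NavierStokesRegularity.Theorems.QuietScarPocketDoorDefs
import Summits.NavierStokesRegularity.NavierStokesRegularity.Theorems.RellichScarSymmetricScarExistsApexRieszPressureBounds
import Literature.Analysis.FluidPDE.TypeIAncientMildDecay
import Literature.Analysis.FluidPDE.PineauVicolPressureIdentification

/-!
# QuietScarPocketDoorZoomOffApex — door S31 «QuietScarPocketDoor», PK1 stub **F4b**
# `offApexClassical_of_typeIAncientMild` (OFF-APEX CLASSICAL DATA OF THE LIMIT)

Seat nsreg-C26-p1 g4 (width seat under LEAD ns-s30-p1, DIRECTOR-NS #202 (2) / #203 (b)); signature VERBATIM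
from the LEAD's skeleton `HOME/ns-s30-p1/PK1-Skeleton.lean` (sha16 e9d92a063109a968), text nsreg-p1 g25 (Sketch31
§1 `OffApexClassical`).  `--supports stmt-NavierStokesRegularity-0056 --as helper`.

**F4b.**  A Type-I ancient mild field `U` (KNSS gauge, constant `C_u`) whose ONE-POINT (apex) bound
`‖U(s,y)‖ ≤ C_u/(‖y‖ + √(−s))` holds a.e. on the past is classical OFF THE APEX on `(−1,0) × (ℝ³∖{0})` for a
pressure bounded on every shell `δ ≤ ‖x‖ ≤ δ⁻¹` uniformly up to the top (`OffApexClassical C_u U`).  Tree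
assembly, no new analysis:

* `hasTypeIDecay_of_ae` — the a.e. bound is a POINTWISE bound (both sides are continuous on the open past;
  `max`-trick + `Measure.eqOn_open_of_ae_eq`);
* ONE classical pressure `P` on the whole past: Fabes–Jones–Rivière on the windows `(−(k+1), 0)`
  (`IsTypeIAncientMild.exists_isClassicalNSSolutionOn_Ioo`) patched by
  `IsClassicalNSSolutionOn.exists_pressure_Iio_of_Ioo` (the tree's pattern of `TypeIAncientMildDecay`; inlined);
* the RIESZ PRESSURE BOUNDS of the tree, `SymmetricScarExists.LogtimeBernoulli.apexRieszPressure_scaleInvariantBounds`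
  (`(‖x‖ + √(−t))² |Q[U(t)](x)| ≤ K(C_u)` for classical Type-I solutions on the past, `Q = pressurePotential`);
* the IDENTIFICATION `∇P(t) = ∇Q[U(t)]` on `(−1,0)` (`PineauVicol2026.gradient_pressure_eq_of_typeI`, Tao's
  pressure normalisation on the decay class), whence `P(t,x) − P(t,e) = Q[U(t)](x) − Q[U(t)](e)`;
* the RE-GAUGED pressure `q(t,x) := P(t,x) − P(t,e)` at a unit vector `e` (NOT at the apex): jointly smooth, same
  gradient, hence `(U,q)` is classical on `(−1,0) × (ℝ³∖{0})`, and `|q(t,x)| ≤ K/δ² + K` on the shells.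

WHAT THIS IS NOT: a width stub of the K-piece `ScarPocketZoom` of a regularity CRITERION about hypothetical Type-I
profiles; item 0056 `NoTypeII`, door S31 and Navier–Stokes regularity are NOT proved here.
[KochNadirashviliSereginSverak2009 §4; FabesJonesRiviere1972 Thm. 2.1; PineauVicol2026 Lemma 2.1/7.1; Tao2011 Lemma 4.1 (i).]
-/

noncomputable section

set_option linter.dupNamespace false

namespace Summit.NavierStokesRegularity.NavierStokesRegularity.Theorems.QuietScarPocketDoor

open MeasureTheory Set Function Filter Topology TopologicalSpace Metric
open scoped NNReal ENNReal Topology ContDiff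
open Literature.Analysis Literature.Analysis.FluidPDE
open Summit.NavierStokesRegularity.NavierStokesRegularity.Theorems.SymmetricScarExists.LogtimeBernoulli
  (apexRieszPressure_scaleInvariantBounds)

/-- **An a.e. one-point bound of a Type-I ancient mild field holds everywhere**: both `‖U‖` and the envelope
`C/(‖y‖ + √(−s))` are continuous on the open past, so `max ‖U‖ envelope = envelope` a.e. upgrades to everywhere
(`Measure.eqOn_open_of_ae_eq`). [folklore] -/
theorem hasTypeIDecay_of_ae {Cu : ℝ} {U : ℝ → EuclideanSpace ℝ (Fin 3) → EuclideanSpace ℝ (Fin 3)}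
    (hU : IsTypeIAncientMild Cu U)
    (hone : ∀ᵐ z ∂(volume.restrict (Iio (0 : ℝ) ×ˢ (univ : Set (EuclideanSpace ℝ (Fin 3))))),
      ‖U z.1 z.2‖ ≤ Cu / (‖z.2‖ + Real.sqrt (-z.1))) :
    HasTypeIDecay Cu U := by
  set O : Set (ℝ × EuclideanSpace ℝ (Fin 3)) := Iio (0 : ℝ) ×ˢ univ with hO
  have hOo : IsOpen O := isOpen_Iio.prod isOpen_univ
  set g : ℝ × EuclideanSpace ℝ (Fin 3) → ℝ := fun z => Cu / (‖z.2‖ + Real.sqrt (-z.1)) with hg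
  set f : ℝ × EuclideanSpace ℝ (Fin 3) → ℝ := fun z => max ‖U z.1 z.2‖ (g z) with hf
  have hgc : ContinuousOn g O := by
    refine ContinuousOn.div continuousOn_const ?_ fun z hz => ?_
    · exact (continuous_norm.comp continuous_snd).continuousOn.add
        ((Real.continuous_sqrt.comp (continuous_neg.comp continuous_fst)).continuousOn)
    · have hz1 : z.1 < 0 := (mem_prod.1 hz).1
      have : 0 < Real.sqrt (-z.1) := Real.sqrt_pos.2 (by linarith)
      positivity
  have hUc : ContinuousOn (fun z : ℝ × EuclideanSpace ℝ (Fin 3) => ‖U z.1 z.2‖) O :=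
    (hU.1.continuousOn).norm
  have hfc : ContinuousOn f O := continuous_max.comp_continuousOn (hUc.prodMk hgc)
  have hae : f =ᵐ[volume.restrict O] g := by
    filter_upwards [hone] with z hz
    exact max_eq_right hz
  have hEq : EqOn f g O := Measure.eqOn_open_of_ae_eq hae hOo hfc hgc
  intro t ht x
  have hz : ((t, x) : ℝ × EuclideanSpace ℝ (Fin 3)) ∈ O := mk_mem_prod ht (mem_univ _)
  have h := hEq hz
  simp only [hf, hg] at h
  exact (le_max_left _ _).trans h.le

/-- **Re-gauging the pressure by a function of time keeps a classical solution classical**: subtracting the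
value at a fixed point `e`, `q(t,x) = p(t,x) − p(t,e)`. [folklore] -/
theorem isClassicalNSSolutionOn_pressure_sub_apply {S : Set ℝ} {ν : ℝ}
    {u : ℝ → EuclideanSpace ℝ (Fin 3) → EuclideanSpace ℝ (Fin 3)} {p : ℝ → EuclideanSpace ℝ (Fin 3) → ℝ}
    (h : IsClassicalNSSolutionOn S ν 0 u p) (e : EuclideanSpace ℝ (Fin 3)) :
    IsClassicalNSSolutionOn S ν 0 u (fun t x => p t x - p t e) where
  smooth_velocity := h.smooth_velocity
  smooth_pressure := by
    have hp : ContDiffOn ℝ ∞ (uncurry p) (S ×ˢ univ) := h.smooth_pressure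
    have hpe : ContDiffOn ℝ ∞ (fun z : ℝ × EuclideanSpace ℝ (Fin 3) => uncurry p (z.1, e)) (S ×ˢ univ) :=
      hp.comp (contDiffOn_fst.prodMk contDiffOn_const) fun z hz =>
        mk_mem_prod (mem_prod.1 hz).1 (mem_univ _)
    exact hp.sub hpe
  momentum t ht x := by
    rw [gradient_sub_const]
    exact h.momentum t ht x
  divFree := h.divFree

/-- **F4b (OFF-APEX CLASSICAL DATA OF THE LIMIT)** — signature VERBATIM from the LEAD's PK1 skeleton: a Type-I
ancient mild field with the a.e. one-point bound is classical off the apex on `(−1,0) × (ℝ³∖{0})` with the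
pointwise one-point bound and a pressure bounded on shells uniformly up to the top (the re-gauged classical
pressure `P − P(·,e)`, `‖e‖ = 1`, controlled by the tree's Riesz-pressure bounds through
`∇P = ∇Q[U]`). [cite: PineauVicol2026, Lemma 2.1 (pp. 9–10) and Lemma 7.1 (pp. 23–24); FabesJonesRiviere1972, Thm. 2.1] -/
theorem offApexClassical_of_typeIAncientMild {Cu : ℝ} {U : ℝ → EuclideanSpace ℝ (Fin 3) → EuclideanSpace ℝ (Fin 3)}
    (hCu : 0 < Cu) (hU : IsTypeIAncientMild Cu U)
    (hone : ∀ᵐ z ∂(volume.restrict (Iio (0 : ℝ) ×ˢ (univ : Set (EuclideanSpace ℝ (Fin 3))))),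
      ‖U z.1 z.2‖ ≤ Cu / (‖z.2‖ + Real.sqrt (-z.1))) :
    OffApexClassical Cu U := by
  have hdec : HasTypeIDecay Cu U := hasTypeIDecay_of_ae hU hone
  -- ONE classical pressure on the whole past (Fabes–Jones–Rivière on the windows `(−(k+1),0)`, patched;
  -- the tree's pattern of `TypeIAncientMildDecay`, cf. `…FineRatioWindowsExcluded.exists_classical_Iio`)
  obtain ⟨P, hP⟩ : ∃ P : ℝ → EuclideanSpace ℝ (Fin 3) → ℝ, IsClassicalNSSolutionOn (Iio 0) 1 0 U P := by
    have hwin : ∀ k : ℕ, ∃ q : ℝ → EuclideanSpace ℝ (Fin 3) → ℝ,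
        IsClassicalNSSolutionOn (Ioo (-((k : ℝ) + 1)) 0) 1 0 U q := fun k =>
      hU.exists_isClassicalNSSolutionOn_Ioo (t₀ := -((k : ℝ) + 1)) (by
        have : (0 : ℝ) ≤ k := Nat.cast_nonneg k
        linarith)
    choose q hq using hwin
    refine IsClassicalNSSolutionOn.exists_pressure_Iio_of_Ioo (a := fun k : ℕ => -((k : ℝ) + 1)) hq
      fun s hs => ⟨⌈-s⌉₊, ?_⟩
    have h1 : -s ≤ (⌈-s⌉₊ : ℝ) := Nat.le_ceil (-s)
    show -((⌈-s⌉₊ : ℝ) + 1) < s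
    linarith
  obtain ⟨K, hK0, hK⟩ := apexRieszPressure_scaleInvariantBounds Cu
  -- the unit vector `e` at which the pressure is re-gauged
  set e : EuclideanSpace ℝ (Fin 3) := EuclideanSpace.single 0 1 with he_def
  have he : ‖e‖ = 1 := by simp [he_def]
  set q : ℝ → EuclideanSpace ℝ (Fin 3) → ℝ := fun t x => P t x - P t e with hq
  -- classical on the window `(−1,0)` (and on `[−1,0)` for the identification lemma)
  have hPIco : IsClassicalNSSolutionOn (Ico (-1 : ℝ) 0) 1 0 U P :=
    hP.mono (fun t ht => ht.2) (uniqueDiffOn_Ico (-1 : ℝ) 0)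
  have hPIoo : IsClassicalNSSolutionOn (Ioo (-1 : ℝ) 0) 1 0 U P :=
    hP.mono (fun t ht => ht.2) isOpen_Ioo.uniqueDiffOn
  have hqIoo : IsClassicalNSSolutionOn (Ioo (-1 : ℝ) 0) 1 0 U q :=
    isClassicalNSSolutionOn_pressure_sub_apply hPIoo e
  -- the identification `P(t,x) − P(t,e) = Q[U t](x) − Q[U t](e)` on `(−1,0)`
  have hident : ∀ t ∈ Ioo (-1 : ℝ) 0, ∀ x : EuclideanSpace ℝ (Fin 3),
      q t x = pressurePotential (U t) x - pressurePotential (U t) e := by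
    intro t ht x
    have hgrad : ∀ y, gradient (P t) y = gradient (pressurePotential (U t)) y := fun y =>
      PineauVicol2026.gradient_pressure_eq_of_typeI hPIco (fun s hs y => hdec s hs.2 y) ht y
    -- `P t` and `Q[U t]` are differentiable
    have htI : t ∈ Iio (0 : ℝ) := ht.2
    have hp1 : Differentiable ℝ (P t) := (hP.contDiff_pressure htI).differentiable (by simp)
    have hst : 0 < Real.sqrt (-t) := Real.sqrt_pos.2 (by linarith [ht.2])
    have hdec1 : ∀ y, ‖U t y‖ ≤ Cu * max 1 (Real.sqrt (-t))⁻¹ / (1 + ‖y‖) := by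
      intro y
      have h1 := hdec t htI y
      rw [le_div_iff₀ (by positivity)]
      rw [div_eq_mul_inv] at h1
      have hpos : 0 < ‖y‖ + Real.sqrt (-t) := by positivity
      have h2 : ‖U t y‖ * (‖y‖ + Real.sqrt (-t)) ≤ Cu := by
        have := mul_le_mul_of_nonneg_right h1 hpos.le
        rwa [mul_assoc, inv_mul_cancel₀ hpos.ne', mul_one] at this
      have hCu0 : 0 ≤ Cu := hCu.le
      -- `‖U‖(1+‖y‖) ≤ ‖U‖ (‖y‖ + √(−t)) · max(1, 1/√(−t))`
      have h3 : 1 + ‖y‖ ≤ (‖y‖ + Real.sqrt (-t)) * max 1 (Real.sqrt (-t))⁻¹ := by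
        have hm1 : 1 ≤ max 1 (Real.sqrt (-t))⁻¹ := le_max_left _ _
        have hm2 : 1 ≤ Real.sqrt (-t) * max 1 (Real.sqrt (-t))⁻¹ := by
          calc (1 : ℝ) = Real.sqrt (-t) * (Real.sqrt (-t))⁻¹ := (mul_inv_cancel₀ hst.ne').symm
            _ ≤ Real.sqrt (-t) * max 1 (Real.sqrt (-t))⁻¹ :=
                mul_le_mul_of_nonneg_left (le_max_right _ _) hst.le
        nlinarith [norm_nonneg y]
      calc ‖U t y‖ * (1 + ‖y‖) ≤ ‖U t y‖ * ((‖y‖ + Real.sqrt (-t)) * max 1 (Real.sqrt (-t))⁻¹) :=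
            mul_le_mul_of_nonneg_left h3 (norm_nonneg _)
        _ = ‖U t y‖ * (‖y‖ + Real.sqrt (-t)) * max 1 (Real.sqrt (-t))⁻¹ := by ring
        _ ≤ Cu * max 1 (Real.sqrt (-t))⁻¹ :=
            mul_le_mul_of_nonneg_right h2 (le_trans zero_le_one (le_max_left _ _))
    have hu4 : ContDiff ℝ 4 (U t) := contDiff_infty.1 (hP.contDiff_velocity htI) 4
    have hQ2 : ContDiff ℝ 2 (pressurePotential (U t)) :=
      PineauVicol2026.contDiff_pressurePotential_decay hu4 hdec1
    have hQd : Differentiable ℝ (pressurePotential (U t)) := hQ2.differentiable (by norm_num)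
    have hdiff : Differentiable ℝ fun y => P t y - pressurePotential (U t) y := hp1.sub hQd
    have hzero : ∀ y, fderiv ℝ (fun y => P t y - pressurePotential (U t) y) y = 0 := by
      intro y
      rw [fderiv_fun_sub (hp1 y) (hQd y)]
      have h := hgrad y
      unfold gradient at h
      have h' := congrArg (InnerProductSpace.toDual ℝ (EuclideanSpace ℝ (Fin 3))) h
      simp only [LinearIsometryEquiv.apply_symm_apply] at h'
      rw [h', sub_self]
    have hconst := is_const_of_fderiv_eq_zero hdiff hzero x e
    simp only [hq]
    linarith
  refine ⟨q, ?_, fun s hs x _ => hdec s hs.2 x, fun δ hδ => ?_⟩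
  · -- classical on the off-apex region
    have hreg : IsClassicalNSSolutionOnRegion (Ioo (-1 : ℝ) 0 ×ˢ (univ : Set (EuclideanSpace ℝ (Fin 3))))
        1 0 U q := hqIoo.onRegion
    exact hreg.mono_of_isOpen (prod_mono le_rfl (subset_univ _))
      (isOpen_Ioo.prod isOpen_compl_singleton)
  · -- the shell bound `|q| ≤ K/δ² + K`
    refine ⟨K / δ ^ 2 + K, fun s hs x hδx _ => ?_⟩
    have hs0 : s < 0 := hs.2
    have hst : 0 < Real.sqrt (-s) := Real.sqrt_pos.2 (by linarith)
    have hQx := (hK U P hP hdec s hs0 x).1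
    have hQe := (hK U P hP hdec s hs0 e).1
    rw [he] at hQe
    have hx0 : 0 < ‖x‖ := lt_of_lt_of_le hδ hδx
    -- `|Q[U s](x)| ≤ K/δ²`
    have h1 : |pressurePotential (U s) x| ≤ K / δ ^ 2 := by
      rw [le_div_iff₀ (by positivity)]
      have hle : δ ^ 2 ≤ (‖x‖ + Real.sqrt (-s)) ^ 2 := by
        have : δ ≤ ‖x‖ + Real.sqrt (-s) := hδx.trans (le_add_of_nonneg_right hst.le)
        exact pow_le_pow_left₀ hδ.le this 2
      calc |pressurePotential (U s) x| * δ ^ 2 ≤ |pressurePotential (U s) x| * (‖x‖ + Real.sqrt (-s)) ^ 2 :=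
            mul_le_mul_of_nonneg_left hle (abs_nonneg _)
        _ = (‖x‖ + Real.sqrt (-s)) ^ 2 * |pressurePotential (U s) x| := mul_comm _ _
        _ ≤ K := hQx
    -- `|Q[U s](e)| ≤ K`
    have h2 : |pressurePotential (U s) e| ≤ K := by
      have hle : (1 : ℝ) ≤ (1 + Real.sqrt (-s)) ^ 2 := by nlinarith [hst.le]
      calc |pressurePotential (U s) e| = 1 * |pressurePotential (U s) e| := (one_mul _).symm
        _ ≤ (1 + Real.sqrt (-s)) ^ 2 * |pressurePotential (U s) e| :=
            mul_le_mul_of_nonneg_right hle (abs_nonneg _)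
        _ ≤ K := hQe
    rw [hident s hs x]
    calc |pressurePotential (U s) x - pressurePotential (U s) e|
        ≤ |pressurePotential (U s) x| + |pressurePotential (U s) e| := abs_sub _ _
      _ ≤ K / δ ^ 2 + K := add_le_add h1 h2

end Summit.NavierStokesRegularity.NavierStokesRegularity.Theorems.QuietScarPocketDoor

end
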